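import Mathlib.LinearAlgebra.Matrix.Determinant.Basic
import Mathlib.LinearAlgebra.Matrix.Trace
import Mathlib.LinearAlgebra.Matrix.NonsingularInverse
import Mathlib.LinearAlgebra.Matrix.SchurComplement
import Mathlib.LinearAlgebra.Matrix.BilinearForm
import Mathlib.LinearAlgebra.BilinearForm.Orthogonal
import Mathlib.LinearAlgebra.QuadraticForm.Basic
import Mathlib.FieldTheory.IsAlgClosed.Basic
import Mathlib.LinearAlgebra.Matrix.GeneralLinearGroup.Defs
import Mathlib.LinearAlgebra.Matrix.GeneralLinearGroup.Basic
import Mathlib.GroupTheory.QuotientGroup.Basic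
import Mathlib.Topology.Instances.Matrix
import Mathlib.Topology.Algebra.Group.Quotient
import Mathlib.Topology.Algebra.GroupWithZero
import Mathlib.Topology.Algebra.Constructions
import Mathlib.Data.Matrix.Mul
import Mathlib.Tactic.Ring
import Mathlib.Tactic.FinCases
import Mathlib.Tactic.FieldSimp
import Mathlib.Tactic.Module
import Mathlib.Data.Fin.VecNotation
import Mathlib.LinearAlgebra.Matrix.Notation
import Literature.NumberTheory.GaloisRepresentations.TateSpinLift
import Literature.NumberTheory.GaloisRepresentations.ProjectiveLifting
import HarnessLib

/-!
# Spin lifts through `D₃ = A₃`: reduction of the Proposition for `GSpin₆ ↠ SO₆` to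
# Tate's `ℓ`-adic projective lifting theorem

Sibling proof file of `TateSpinLift.lean` (named fact `Patrikis2019_exists_spinLift`) and home of
the ramification-free statement (the Proposition alone, formerly the separate named fact
`Patrikis2019_exists_spinLift_of_continuous` of `TateSpinLiftContinuous.lean`, merged into
`Patrikis2019_exists_lift_projective` by the D-0026/D-0027 review of 2026-08-15: it is the PROVED
corollary `Patrikis2019_exists_spinLift_of_continuous_of_lift_projective` below, whose conclusion
is now written out explicitly).

**The printed proof.** S. Patrikis, *Variations on a theorem of Tate*, Mem. AMS 258 (2019),
no. 1238, Ch. 2 §2.1 (= arXiv:1207.6724, Prop. 1.0.18, held text p. 14, "(5.3 of [conrad:dualGW])"):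
"Let `H' ↠ H` be a surjection of linear algebraic groups over `ℚ̄_ℓ` with kernel a central torus.
Then any continuous representation `ρ : Γ_F → H(ℚ̄_ℓ)` lifts to `H'(ℚ̄_ℓ)`"; proof (p. 15):
isogeny complement `H'_1`, `H'_n = H'_1 · S∨[n] ↠ H` with kernel `μ_n`, obstruction classes
`c_n ∈ H²(Γ_F, ℤ/n)`, killed in `lim H²(Γ_F, ℤ/n) = H²(Γ_F, ℚ/ℤ) = 0` (Tate, Thm. 1.0.16 = Serre,
Durham survey, Thm. 4).  The spin-lift statements are the instance `H' = GSpin₆ ↠ H = SO₆`, read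
through `D₃ = A₃`; the tree's `Patrikis2019_exists_lift_projective` (`ProjectiveLifting.lean`)
is the instance `GL₄ ↠ PGL₄` of the same Proposition (its part (i); part (ii) = the Remark after
it, Conrad Lemma 5.2), itself reduced in `ProjectiveLiftingProofs.lean` to exactly the vanishing
statement Tate's theorem supplies (and proved EQUIVALENT to Tate's theorem in cochain form for
all number fields, `Patrikis2019_exists_lift_projective_iff_H2_addCircle`,
`TateH2ReductionProofs.lean`).  Tate's theorem (global class field theory) is not proved in
Mathlib or in the tree, so nothing is discharged here; what this file proves is the
`D₃ = A₃` transfer, i.e. the implications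

* `Patrikis2019_exists_spinLift_of_continuous_of_lift_projective :
    Patrikis2019_exists_lift_projective → ∀ F ℓ r, (r exactly orthogonal) → (det r = 1) →
      ∃ W ν, ν · tr r = ((tr W)² − tr W(σ²)) / 2` (the Proposition alone, every continuous `r`),
* `Patrikis2019_exists_spinLift_of_lift_projective :
    Patrikis2019_exists_lift_projective → Patrikis2019_exists_spinLift` (with the Remark:
    `r` unramified a.e. ⇒ `W` unramified a.e.),

which is precisely the "algebra which is not in the tree" announced in the docstring of
`ProjectiveLifting.lean` ("The `D₃ = A₃` consequence used by route Langlands/K3KugaSatakeDescent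
… is this fact at `n = 4` composed with the exceptional isogeny `Λ² : GL_4 → GSO_6`").

## The transfer (all proved, namespace `SpinLift`)

Let `k` be a field of characteristic `≠ 2` (here `k = ℚ̄_ℓ`), `V = k⁴`, and identify `∧²V ≅ k⁶`
through the Plücker basis `e₀₁, e₀₂, e₀₃, e₁₂, e₁₃, e₂₃`.

* `C2 h` — the second compound matrix (matrix of `∧²h`, entries the `2 × 2` minors of `h`);
  `C2_mul` (Cauchy–Binet), `two_mul_trace_C2` (`2 tr ∧²h = (tr h)² − tr h²`).
* `Q0` — the Gram matrix of the wedge pairing `x ∧ y ∈ ∧⁴V ≅ k` (signed anti-diagonal,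
  symmetric, `Q0² = 1`); `pf` — the Pfaffian, `u ⬝ Q0 u = 2 pf u`.
* `N` — an explicit quadratic map `M₆ → M₄` with `N (C2 h) = 2 M₁₂₃(h) • h` (`N_C2`; Laplace /
  Sylvester identities, checked by `ring`).  Consequences: the KERNEL of `h ↦ [C2 h]` is the
  scalars (`exists_eq_smul_of_C2_eq_smul`), and `[N g]` is a polynomial LOCAL INVERSE of
  `[h] ↦ [C2 h]` near `1`, whence continuity of the lift (`continuous_liftHom`).
* SURJECTIVITY onto `SO(Q0)(k)` (`exists_eq_smul_C2`: `Gᵀ Q0 G = Q0`, `det G = 1` ⇒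
  `G = c • C2 h`, `c ≠ 0`, `h` invertible): weak Cartan–Dieudonné (`exists_list_prod_refl_eq`:
  every isometry of a nondegenerate symmetric bilinear form in characteristic `≠ 2` is a product
  of reflections — induction on the number of vectors of an orthogonal anisotropic basis not yet
  fixed), `det (reflection) = −1` so the number of reflections is even, and the explicit preimage
  of a PAIR of reflections `s_u s_w = (pf u · pf w)⁻¹ C2 (U · W̃)` (`C2_skew_mul_skew_star`;
  `U = skew u`, `W̃` the Pfaffian adjugate, `U Ũ = pf(U) · 1`).
* `exists_transpose_mul_mul_eq` — any two invertible symmetric matrices over an algebraically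
  closed field of characteristic `≠ 2` are congruent (`Pᵀ J P = Q0`), from Mathlib's
  `LinearMap.BilinForm.exists_orthogonal_basis` and square roots.
* `liftHom` / `continuous_liftHom` — the continuous homomorphism `Γ → PGL₄(k)` (quotient
  topology) attached to a continuous `SO(Q0)`-valued `g`, and
  `exists_C2_eq_smul_of_mk_eq_liftHom` — any `W` lifting it has `∧²W(σ) = ν(σ) g(σ)`.

Assembly (`exists_projective_spinDatum`): conjugate `r` into `SO(Q0)` by `P`, lift
`φ = liftHom (P⁻¹ r P)` with `Patrikis2019_exists_lift_projective`, read off the continuous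
character `ν` (`ν σ = tr(∧²W(σ) g(σ)⁻¹) / 6`) and the trace identity
`ν(σ) tr r(σ) = tr ∧²W(σ) = ((tr W σ)² − tr W(σ²)) / 2`; inertia dying under `r` dies under `φ`,
which feeds part (ii) of the projective fact for the almost-everywhere-unramified version.

## References

* [Patrikis2019] S. Patrikis, *Variations on a theorem of Tate*, Mem. Amer. Math. Soc. 258
  (2019), no. 1238, Ch. 2 §2.1, Proposition (lifting through central torus quotients) and the
  Remark after it (= arXiv:1207.6724 Prop. 1.0.18, Rem. 1.0.19).
* B. Conrad, *Lifting global representations with local properties*, preprint (2011), Prop. 5.3,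
  Lemma 5.2.
* W. Fulton, J. Harris, *Representation Theory*, GTM 129, §19–20 (`Spin₆ ≅ SL₄`, `∧²` of the
  standard representation and the Klein quadric) — for the `D₃ = A₃` dictionary. [folklore]
-/

noncomputable section

namespace Literature.NumberTheory.GaloisRepresentations

namespace SpinLift

open Matrix

section CommRing

variable {R : Type*} [CommRing R]

/-- First index of the `a`-th pair in the Plücker order `01,02,03,12,13,23`. [folklore] -/
def pI : Fin 6 → Fin 4 := ![0, 0, 0, 1, 1, 2]

/-- Second index of the `a`-th pair in the Plücker order `01,02,03,12,13,23`. [folklore] -/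
def pJ : Fin 6 → Fin 4 := ![1, 2, 3, 2, 3, 3]

/-- The second compound matrix `C₂(h)` of a `4 × 4` matrix: the `6 × 6` matrix of its `2 × 2`
minors in the Plücker order, i.e. the matrix of `∧²h` on `∧²R⁴`. [folklore] -/
def C2 (h : Matrix (Fin 4) (Fin 4) R) : Matrix (Fin 6) (Fin 6) R :=
  Matrix.of fun a b => h (pI a) (pI b) * h (pJ a) (pJ b) - h (pI a) (pJ b) * h (pJ a) (pI b)

/-- Entries of `C2 h`: the `2 × 2` minors of `h`. [folklore] -/
theorem C2_apply (h : Matrix (Fin 4) (Fin 4) R) (a b : Fin 6) :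
    C2 h a b = h (pI a) (pI b) * h (pJ a) (pJ b) - h (pI a) (pJ b) * h (pJ a) (pI b) := rfl

/-- `C₂` is multiplicative (Cauchy–Binet for `2 × 2` minors). [folklore] -/
theorem C2_mul (g h : Matrix (Fin 4) (Fin 4) R) : C2 (g * h) = C2 g * C2 h := by
  ext a b
  fin_cases a <;> fin_cases b <;>
    simp [C2, Matrix.mul_apply, Fin.sum_univ_four, Fin.sum_univ_six, pI, pJ] <;> ring

/-- `C₂(1) = 1`. [folklore] -/
@[simp] theorem C2_one : C2 (1 : Matrix (Fin 4) (Fin 4) R) = 1 := by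
  ext a b
  fin_cases a <;> fin_cases b <;> simp [C2, Matrix.one_apply, pI, pJ]

/-- `C₂` is homogeneous of degree `2`. [folklore] -/
theorem C2_smul (c : R) (h : Matrix (Fin 4) (Fin 4) R) : C2 (c • h) = c ^ 2 • C2 h := by
  ext a b
  simp [C2, Matrix.smul_apply]
  ring

/-- `tr ∧²h = e₂(h) = ((tr h)² − tr h²) / 2`, cleared of the denominator. [folklore] -/
theorem two_mul_trace_C2 (h : Matrix (Fin 4) (Fin 4) R) :
    2 * (C2 h).trace = h.trace ^ 2 - (h * h).trace := by
  simp [Matrix.trace, Fin.sum_univ_four, Fin.sum_univ_six, C2, Matrix.mul_apply, pI, pJ]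
  ring

/-- The quadratic "inverse" `N : M₆ → M₄` of `C₂` up to scalars: `N (C₂ h) = 2 M₁₂₃(h) • h`
(`M₁₂₃` the lower-right `3 × 3` principal minor), by Laplace/Sylvester identities. [folklore] -/
def N (m : Matrix (Fin 6) (Fin 6) R) : Matrix (Fin 4) (Fin 4) R :=
  !![-(m 0 3 * m 5 2) + m 0 4 * m 5 1 - m 0 5 * m 5 0 - m 1 0 * m 4 5 + m 1 1 * m 4 4
        - m 1 2 * m 4 3 + m 2 0 * m 3 5 - m 2 1 * m 3 4 + m 2 2 * m 3 3,
      -(2 * (m 0 3 * m 5 4)) + 2 * (m 1 3 * m 4 4) - 2 * (m 2 3 * m 3 4),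
      -(2 * (m 0 3 * m 5 5)) + 2 * (m 1 3 * m 4 5) - 2 * (m 2 3 * m 3 5),
      -(2 * (m 0 4 * m 5 5)) + 2 * (m 1 4 * m 4 5) - 2 * (m 2 4 * m 3 5);
    -(2 * (m 3 0 * m 4 5)) + 2 * (m 3 1 * m 4 4) - 2 * (m 3 2 * m 4 3),
      2 * (m 3 3 * m 4 4) - 2 * (m 3 4 * m 4 3),
      2 * (m 3 3 * m 4 5) - 2 * (m 3 5 * m 4 3),
      2 * (m 3 4 * m 4 5) - 2 * (m 3 5 * m 4 4);
    -(2 * (m 3 0 * m 5 5)) + 2 * (m 3 1 * m 5 4) - 2 * (m 3 2 * m 5 3),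
      2 * (m 3 3 * m 5 4) - 2 * (m 3 4 * m 5 3),
      2 * (m 3 3 * m 5 5) - 2 * (m 3 5 * m 5 3),
      2 * (m 3 4 * m 5 5) - 2 * (m 3 5 * m 5 4);
    -(2 * (m 4 0 * m 5 5)) + 2 * (m 4 1 * m 5 4) - 2 * (m 4 2 * m 5 3),
      2 * (m 4 3 * m 5 4) - 2 * (m 4 4 * m 5 3),
      2 * (m 4 3 * m 5 5) - 2 * (m 4 5 * m 5 3),
      2 * (m 4 4 * m 5 5) - 2 * (m 4 5 * m 5 4)]

/-- The lower-right principal `3 × 3` minor of a `4 × 4` matrix. [folklore] -/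
def M123 (h : Matrix (Fin 4) (Fin 4) R) : R :=
  (h.submatrix Fin.succ Fin.succ).det

/-- **The Laplace/Sylvester identity** `N (C₂ h) = 2 M₁₂₃(h) • h` (sixteen polynomial identities in
the entries of `h`). [folklore] -/
theorem N_C2 (h : Matrix (Fin 4) (Fin 4) R) : N (C2 h) = (2 * M123 h) • h := by
  ext i j
  fin_cases i <;> fin_cases j <;>
    simp [N, C2, M123, Matrix.det_fin_three, Matrix.submatrix_apply, pI, pJ,
      Matrix.smul_apply] <;> ring

/-- `N` is homogeneous of degree `2`. [folklore] -/
theorem N_smul (c : R) (m : Matrix (Fin 6) (Fin 6) R) : N (c • m) = c ^ 2 • N m := by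
  ext i j
  fin_cases i <;> fin_cases j <;> simp [N, Matrix.smul_apply] <;> ring

/-- `N(1) = 2 · 1`. [folklore] -/
theorem N_one : N (1 : Matrix (Fin 6) (Fin 6) R) = (2 : R) • 1 := by
  have h := N_C2 (1 : Matrix (Fin 4) (Fin 4) R)
  rw [C2_one] at h
  rw [h, M123, Matrix.submatrix_one _ (Fin.succ_injective _), Matrix.det_one, mul_one]


/-- The Gram matrix of the Plücker pairing `⟨x, y⟩ = x ∧ y ∈ ∧⁴R⁴ ≅ R` on `∧²R⁴ ≅ R⁶` in the
basis `e₀₁, e₀₂, e₀₃, e₁₂, e₁₃, e₂₃`: a symmetric signed anti-diagonal matrix. [folklore] -/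
def Q0 : Matrix (Fin 6) (Fin 6) R :=
  !![0, 0, 0, 0, 0, 1; 0, 0, 0, 0, -1, 0; 0, 0, 0, 1, 0, 0;
     0, 0, 1, 0, 0, 0; 0, -1, 0, 0, 0, 0; 1, 0, 0, 0, 0, 0]

/-- `Q₀` is symmetric. [folklore] -/
theorem Q0_transpose : (Q0 : Matrix (Fin 6) (Fin 6) R)ᵀ = Q0 := by
  ext i j; fin_cases i <;> fin_cases j <;> rfl

/-- `Q₀² = 1`; in particular `Q₀` is invertible. [folklore] -/
theorem Q0_mul_Q0 : (Q0 : Matrix (Fin 6) (Fin 6) R) * Q0 = 1 := by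
  ext i j
  fin_cases i <;> fin_cases j <;> simp [Q0, Matrix.mul_apply, Fin.sum_univ_six]

/-- The Pfaffian of the skew `4 × 4` matrix with upper entries `u` (Plücker order). [folklore] -/
def pf (u : Fin 6 → R) : R := u 0 * u 5 - u 1 * u 4 + u 2 * u 3

/-- The Plücker pairing in coordinates. [folklore] -/
theorem dotProduct_Q0_mulVec (u w : Fin 6 → R) :
    u ⬝ᵥ (Q0 *ᵥ w) = u 0 * w 5 - u 1 * w 4 + u 2 * w 3 + u 3 * w 2 - u 4 * w 1 + u 5 * w 0 := by
  simp [Q0, Matrix.mulVec, dotProduct, Fin.sum_univ_six]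
  ring

/-- The Plücker quadratic form is twice the Pfaffian: `u ∧ u = 2 pf(u) e₀₁₂₃`. [folklore] -/
theorem dotProduct_Q0_mulVec_self (u : Fin 6 → R) : u ⬝ᵥ (Q0 *ᵥ u) = 2 * pf u := by
  rw [dotProduct_Q0_mulVec, pf]; ring

/-- `Q₀ u` in coordinates. [folklore] -/
theorem Q0_mulVec_apply (u : Fin 6 → R) :
    Q0 *ᵥ u = ![u 5, -u 4, u 3, u 2, -u 1, u 0] := by
  ext i; fin_cases i <;> simp [Q0, Matrix.mulVec, dotProduct, Fin.sum_univ_six]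

/-- The Hodge-star / Pfaffian-adjugate involution on `R⁶`. [folklore] -/
def star (u : Fin 6 → R) : Fin 6 → R := ![-u 5, u 4, -u 3, -u 2, u 1, -u 0]

/-- The star is an involution. [folklore] -/
@[simp] theorem star_star (u : Fin 6 → R) : star (star u) = u := by
  ext i; fin_cases i <;> simp [star]

/-- The star preserves the Pfaffian. [folklore] -/
@[simp] theorem pf_star (u : Fin 6 → R) : pf (star u) = pf u := by
  simp [pf, star]; ring

/-- The skew-symmetric `4 × 4` matrix with upper-triangular entries `u` (Plücker order). [folklore]
-/
def skew (u : Fin 6 → R) : Matrix (Fin 4) (Fin 4) R :=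
  !![0, u 0, u 1, u 2; -u 0, 0, u 3, u 4; -u 1, -u 3, 0, u 5; -u 2, -u 4, -u 5, 0]

/-- Pfaffian adjugate identity `U · Ũ = pf(U) · 1`. [folklore] -/
theorem skew_mul_skew_star (u : Fin 6 → R) : skew u * skew (star u) = pf u • (1 : Matrix _ _ R) :=
by
  ext i j
  fin_cases i <;> fin_cases j <;>
    simp [skew, star, pf, Matrix.mul_apply, Fin.sum_univ_four, Matrix.smul_apply] <;> ring

/-- Pfaffian adjugate identity on the other side, `Ũ · U = pf(U) · 1`. [folklore] -/
theorem skew_star_mul_skew (u : Fin 6 → R) : skew (star u) * skew u = pf u • (1 : Matrix _ _ R) :=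
by
  simpa using skew_mul_skew_star (star u)

/-- The matrix of `star`. [folklore] -/
def Smat : Matrix (Fin 6) (Fin 6) R :=
  !![0, 0, 0, 0, 0, -1; 0, 0, 0, 0, 1, 0; 0, 0, 0, -1, 0, 0;
     0, 0, -1, 0, 0, 0; 0, 1, 0, 0, 0, 0; -1, 0, 0, 0, 0, 0]

/-- `Smat` is the matrix of `star`. [folklore] -/
theorem Smat_mulVec (u : Fin 6 → R) : Smat *ᵥ u = star u := by
  ext i; fin_cases i <;> simp [Smat, star, Matrix.mulVec, dotProduct, Fin.sum_univ_six]

/-- `Smat² = 1`. [folklore] -/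
theorem Smat_mul_Smat : (Smat : Matrix (Fin 6) (Fin 6) R) * Smat = 1 := by
  ext i j
  fin_cases i <;> fin_cases j <;> simp [Smat, Matrix.mul_apply, Fin.sum_univ_six]

/-- `R_u = pf(u) · 1 − u (Q₀u)ᵀ = pf(u) · s_u`, the numerator of the reflection `s_u` in `u`
for the Plücker form. [folklore] -/
def Rm (u : Fin 6 → R) : Matrix (Fin 6) (Fin 6) R := pf u • (1 : Matrix _ _ R) - vecMulVec u (Q0 *ᵥ
u)

/-- Entries of `R_u`. [folklore] -/
theorem Rm_apply (u : Fin 6 → R) (i j : Fin 6) :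
    Rm u i j = pf u * (1 : Matrix (Fin 6) (Fin 6) R) i j - u i * (Q0 *ᵥ u) j := by
  simp [Rm, vecMulVec_apply, Matrix.sub_apply, Matrix.smul_apply]

/-- `C₂` of a skew matrix is the reflection numerator composed with the star. [folklore] -/
theorem C2_skew (u : Fin 6 → R) : C2 (skew u) = Rm u * Smat := by
  ext a b
  fin_cases a <;> fin_cases b <;>
    simp [C2, skew, pI, pJ, Rm_apply, Smat, Q0_mulVec_apply, pf, Matrix.mul_apply,
      Fin.sum_univ_six, Matrix.one_apply] <;> ring

/-- Conjugating the reflection numerator of `⋆w` by the star gives that of `w` (the star is an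
isometry of the Plücker form preserving the Pfaffian). [folklore] -/
theorem Smat_mul_Rm_star_mul_Smat (u : Fin 6 → R) : Smat * Rm (star u) * Smat = Rm u := by
  have h1 : (Smat : Matrix (Fin 6) (Fin 6) R) *ᵥ star u = u := by rw [Smat_mulVec, star_star]
  have h2 : (Q0 *ᵥ star u) ᵥ* (Smat : Matrix (Fin 6) (Fin 6) R) = Q0 *ᵥ u := by
    rw [Q0_mulVec_apply, Q0_mulVec_apply]
    ext i
    fin_cases i <;> simp [Smat, star, Matrix.vecMul, dotProduct, Fin.sum_univ_six]
  rw [Rm, Rm, pf_star, Matrix.mul_sub, Matrix.sub_mul, Matrix.mul_smul, Matrix.mul_one,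
    Matrix.smul_mul, Smat_mul_Smat, Matrix.mul_vecMulVec, Matrix.vecMulVec_mul, h1, h2]

/-- **Preimage of a pair of reflections**: `C₂(U · W̃) = R_u · R_w`. [folklore] -/
theorem C2_skew_mul_skew_star (u w : Fin 6 → R) :
    C2 (skew u * skew (star w)) = Rm u * Rm w := by
  rw [C2_mul, C2_skew, C2_skew, Matrix.mul_assoc, ← Matrix.mul_assoc Smat,
    Smat_mul_Rm_star_mul_Smat]


end CommRing

section Reflections

open LinearMap (BilinForm)

variable {K V : Type*} [Field K] [AddCommGroup V] [Module K V]

/-- The reflection (orthogonal symmetry) in an anisotropic vector `u` for the bilinear form `B`,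
`x ↦ x − (2 B(u,x) / B(u,u)) u`, as an endomorphism. [folklore] -/
def refl (B : BilinForm K V) (u : V) : Module.End K V :=
  LinearMap.id - (2 / B u u) • (B u).smulRight u

/-- Unfolding lemma for `refl`. [folklore] -/
theorem refl_apply (B : BilinForm K V) (u x : V) :
    refl B u x = x - (2 / B u u * B u x) • u := by
  simp [refl, mul_smul]

/-- A reflection negates its (anisotropic) vector. [folklore] -/
theorem refl_apply_self {B : BilinForm K V} {u : V} (hu : B u u ≠ 0) : refl B u u = -u := by
  rw [refl_apply, div_mul_cancel₀ _ hu, two_smul]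
  abel

/-- A reflection fixes the vectors orthogonal to its vector. [folklore] -/
theorem refl_apply_of_eq_zero {B : BilinForm K V} {u x : V} (h : B u x = 0) : refl B u x = x := by
  simp [refl_apply, h]

/-- Reflections in anisotropic vectors are involutions. [folklore] -/
theorem refl_mul_refl {B : BilinForm K V} {u : V} (hu : B u u ≠ 0) : refl B u * refl B u = 1 := by
  ext x
  change refl B u (refl B u x) = x
  rw [refl_apply B u x, map_sub, map_smul, refl_apply_self hu, refl_apply]
  module

/-- Reflections are isometries of a symmetric form. [folklore] -/
theorem apply_refl_refl {B : BilinForm K V} (hB : B.IsSymm) (u x y : V) :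
    B (refl B u x) (refl B u y) = B x y := by
  by_cases hu : B u u = 0
  · simp [refl_apply, hu]
  simp only [refl_apply, map_sub, map_smul, LinearMap.sub_apply, LinearMap.smul_apply,
    smul_eq_mul, hB.eq x u]
  field_simp
  ring

/-- If `B(w,w) = B(v,v)` and `w - v` is anisotropic, the reflection in `w - v` maps `w` to `v`
(characteristic `≠ 2`). [folklore] -/
theorem refl_sub_apply (h2 : (2 : K) ≠ 0) {B : BilinForm K V} (hB : B.IsSymm) {v w : V}
    (h : B w w = B v v)
    (h' : B (w - v) (w - v) ≠ 0) : refl B (w - v) w = v := by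
  have e : B (w - v) (w - v) = 2 * B (w - v) w := by
    simp only [map_sub, LinearMap.sub_apply, hB.eq v w, h]
    ring
  have ht : B (w - v) w ≠ 0 := by
    intro ht
    rw [ht, mul_zero] at e
    exact h' e
  rw [refl_apply, e]
  have : 2 / (2 * B (w - v) w) * B (w - v) w = 1 := by
    field_simp
  rw [this, one_smul, sub_sub_cancel]

/-- If `B(w,w) = B(v,v)` and `w + v` is anisotropic, the reflection in `w + v` maps `w` to `-v`
(characteristic `≠ 2`). [folklore] -/
theorem refl_add_apply (h2 : (2 : K) ≠ 0) {B : BilinForm K V} (hB : B.IsSymm) {v w : V}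
    (h : B w w = B v v)
    (h' : B (w + v) (w + v) ≠ 0) : refl B (w + v) w = -v := by
  have e : B (w + v) (w + v) = 2 * B (w + v) w := by
    simp only [map_add, LinearMap.add_apply, hB.eq v w, h]
    ring
  have ht : B (w + v) w ≠ 0 := by
    intro ht
    rw [ht, mul_zero] at e
    exact h' e
  rw [refl_apply, e]
  have : 2 / (2 * B (w + v) w) * B (w + v) w = 1 := by
    field_simp
  rw [this, one_smul, sub_add_cancel_left]

/-- **Weak Cartan–Dieudonné.** Over a field of characteristic `≠ 2`, every isometry of a
symmetric bilinear form admitting an orthogonal basis of anisotropic vectors (i.e. nondegenerate)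
is a product of reflections in anisotropic vectors.  Induction on the set of basis vectors not
yet fixed: if `g` fixes `b j` for `j ∉ s`, `i ∈ s`, `v = b i`, `w = g v`, then one of `w ∓ v` is
anisotropic and one or two reflections move `w` back to `v` while still fixing the `b j`.
[folklore] -/
theorem exists_list_prod_refl_eq (h2 : (2 : K) ≠ 0) {ι : Type*} [Fintype ι] [DecidableEq ι]
    {B : BilinForm K V} (hB : B.IsSymm) (b : Module.Basis ι K V) (hbo : B.IsOrthoᵢ b)
    (hba : ∀ i, B (b i) (b i) ≠ 0) (g : Module.End K V) (hg : ∀ x y, B (g x) (g y) = B x y) :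
    ∃ l : List V, (∀ u ∈ l, B u u ≠ 0) ∧ g = (l.map (refl B)).prod := by
  classical
  suffices H : ∀ (s : Finset ι) (g : Module.End K V), (∀ x y, B (g x) (g y) = B x y) →
      (∀ i, i ∉ s → g (b i) = b i) →
        ∃ l : List V, (∀ u ∈ l, B u u ≠ 0) ∧ g = (l.map (refl B)).prod from
    H Finset.univ g hg fun i hi => absurd (Finset.mem_univ i) hi
  intro s
  induction s using Finset.induction_on with
  | empty =>
    intro g _ hfix
    refine ⟨[], by simp, ?_⟩
    rw [List.map_nil, List.prod_nil]
    exact b.ext fun i => by simpa using hfix i (Finset.notMem_empty i)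
  | insert i s hi ih =>
    intro g hg hfix
    have h4 : (4 : K) ≠ 0 := by
      have : (4 : K) = 2 * 2 := by norm_num
      rw [this]
      exact mul_ne_zero h2 h2
    set v := b i with hv
    set w := g v with hw
    have hvv : B v v ≠ 0 := hba i
    have hww : B w w = B v v := hg v v
    have hvj : ∀ j, j ∉ insert i s → B v (b j) = 0 := fun j hj =>
      hbo (by rintro rfl; exact hj (Finset.mem_insert_self _ _))
    have hwj : ∀ j, j ∉ insert i s → B w (b j) = 0 := fun j hj => by
      rw [hw, ← hfix j hj, hg]
      exact hvj j hj
    -- the isometry `τ * g` for an auxiliary `τ` fixing the `b j`, `j ∉ insert i s`, with `τ w = v`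
    have key : ∀ τ : Module.End K V, (∀ x y, B (τ x) (τ y) = B x y) → τ w = v →
        (∀ j, j ∉ insert i s → τ (b j) = b j) →
          ∃ l : List V, (∀ u ∈ l, B u u ≠ 0) ∧ τ * g = (l.map (refl B)).prod := by
      intro τ hτ hτw hτfix
      refine ih (τ * g) (fun x y => by rw [Module.End.mul_apply, Module.End.mul_apply, hτ, hg])
        fun j hj => ?_
      rw [Module.End.mul_apply]
      by_cases hji : j = i
      · subst hji
        exact hτw
      · have hj' : j ∉ insert i s := by simp [hji, hj]
        rw [hfix j hj', hτfix j hj']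
    rcases ne_or_eq (B (w - v) (w - v)) 0 with h1 | h1
    · obtain ⟨l, hl, hprod⟩ := key (refl B (w - v)) (apply_refl_refl hB _)
        (refl_sub_apply h2 hB hww h1) fun j hj =>
          refl_apply_of_eq_zero (u := w - v) (x := b j)
            (by rw [map_sub, LinearMap.sub_apply, hwj j hj, hvj j hj, sub_zero])
      refine ⟨(w - v) :: l, List.forall_mem_cons.2 ⟨h1, hl⟩, ?_⟩
      rw [List.map_cons, List.prod_cons, ← hprod, ← mul_assoc, refl_mul_refl h1, one_mul]
    · have h3 : B (w + v) (w + v) ≠ 0 := by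
        intro h3
        have e : B (w - v) (w - v) + B (w + v) (w + v) = 4 * B v v := by
          simp only [map_sub, map_add, LinearMap.sub_apply, LinearMap.add_apply, hB.eq v w, hww]
          ring
        rw [h1, h3, zero_add] at e
        exact hvv ((mul_eq_zero.1 e.symm).resolve_left h4)
      have hτw : (refl B v * refl B (w + v)) w = v := by
        rw [Module.End.mul_apply, refl_add_apply h2 hB hww h3, map_neg, refl_apply_self hvv,
          neg_neg]
      obtain ⟨l, hl, hprod⟩ := key (refl B v * refl B (w + v))
        (fun x y => by
          rw [Module.End.mul_apply, Module.End.mul_apply, apply_refl_refl hB, apply_refl_refl hB])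
        hτw fun j hj => by
          rw [Module.End.mul_apply,
            refl_apply_of_eq_zero (u := w + v) (x := b j)
              (by rw [map_add, LinearMap.add_apply, hwj j hj, hvj j hj, add_zero]),
            refl_apply_of_eq_zero (u := v) (x := b j) (hvj j hj)]
      refine ⟨(w + v) :: v :: l, List.forall_mem_cons.2 ⟨h3, List.forall_mem_cons.2 ⟨hvv, hl⟩⟩, ?_⟩
      rw [List.map_cons, List.map_cons, List.prod_cons, List.prod_cons, ← hprod,
        ← mul_assoc (refl B v), ← mul_assoc (refl B v), refl_mul_refl hvv, one_mul, ← mul_assoc,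
        refl_mul_refl h3, one_mul]

end Reflections

section MatrixForm

open LinearMap (BilinForm)

variable {K : Type*} [Field K]

/-- An invertible symmetric matrix over a field of characteristic `≠ 2` admits an orthogonal basis
of anisotropic vectors for the bilinear form it defines. [folklore] -/
theorem exists_orthogonal_basis_toBilin' [Invertible (2 : K)] {n : ℕ}
    (M : Matrix (Fin n) (Fin n) K) (hM : M.IsSymm) (hdet : M.det ≠ 0) :
    ∃ b : Module.Basis (Fin n) K (Fin n → K),
      (Matrix.toBilin' M).IsOrthoᵢ b ∧ ∀ i, Matrix.toBilin' M (b i) (b i) ≠ 0 := by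
  have hs : (Matrix.toBilin' M).IsSymm := Matrix.isSymm_toBilin'_iff_isSymm.2 hM
  obtain ⟨v, hv⟩ :=
    LinearMap.BilinForm.exists_orthogonal_basis (LinearMap.BilinForm.isSymm_iff.1 hs)
  have hnd : (Matrix.toBilin' M).Nondegenerate :=
    LinearMap.BilinForm.nondegenerate_toBilin'_iff_det_ne_zero.2 hdet
  let e : Fin (Module.finrank K (Fin n → K)) ≃ Fin n := finCongr (Module.finrank_fin_fun K)
  refine ⟨v.reindex e, ?_, ?_⟩
  · rw [LinearMap.isOrthoᵢ_def]
    intro i j hij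
    rw [Module.Basis.reindex_apply, Module.Basis.reindex_apply]
    exact LinearMap.isOrthoᵢ_def.1 hv _ _ fun h => hij (e.symm.injective h)
  · intro i
    rw [Module.Basis.reindex_apply]
    exact LinearMap.BilinForm.iIsOrtho.not_isOrtho_basis_self_of_nondegenerate hv hnd _

/-- Over an algebraically closed field of characteristic `≠ 2`, every invertible symmetric matrix
is congruent to the identity: `Pᵀ M P = 1` (orthonormalisation). [folklore] -/
theorem exists_transpose_mul_mul_eq_one [IsAlgClosed K] (h2 : (2 : K) ≠ 0) {n : ℕ}
    (M : Matrix (Fin n) (Fin n) K) (hM : M.IsSymm) (hdet : M.det ≠ 0) :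
    ∃ P : Matrix (Fin n) (Fin n) K, P.det ≠ 0 ∧ Pᵀ * M * P = 1 := by
  haveI : Invertible (2 : K) := invertibleOfNonzero h2
  obtain ⟨b, hbo, hba⟩ := exists_orthogonal_basis_toBilin' M hM hdet
  have hsq : ∀ i, ∃ s : K, s ≠ 0 ∧ Matrix.toBilin' M (b i) (b i) = s * s := fun i => by
    obtain ⟨s, hs⟩ := IsAlgClosed.exists_eq_mul_self (Matrix.toBilin' M (b i) (b i))
    refine ⟨s, ?_, hs⟩
    rintro rfl
    exact hba i (by rw [hs, mul_zero])
  choose s hs0 hss using hsq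
  set P : Matrix (Fin n) (Fin n) K := Matrix.of fun a i => (s i)⁻¹ * b i a with hP
  have key : Pᵀ * M * P = 1 := by
    ext i j
    have e : (Pᵀ * M * P) i j = (s i)⁻¹ * (s j)⁻¹ * Matrix.toBilin' M (b i) (b j) := by
      simp only [Matrix.mul_apply, Matrix.transpose_apply, hP, Matrix.of_apply,
        Matrix.toBilin'_apply, Finset.mul_sum, Finset.sum_mul]
      rw [Finset.sum_comm]
      refine Finset.sum_congr rfl fun a _ => Finset.sum_congr rfl fun c _ => ?_
      ring
    rw [e]
    by_cases hij : i = j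
    · subst hij
      have h0 := hs0 i
      rw [hss, Matrix.one_apply_eq]
      field_simp
    · rw [LinearMap.isOrthoᵢ_def.1 hbo i j hij, mul_zero, Matrix.one_apply_ne hij]
  refine ⟨P, fun hP0 => ?_, key⟩
  have hd := congrArg Matrix.det key
  rw [Matrix.det_mul, Matrix.det_mul, Matrix.det_transpose, hP0, mul_zero, Matrix.det_one] at hd
  exact zero_ne_one hd

/-- Two invertible symmetric matrices of the same size over an algebraically closed field of
characteristic `≠ 2` are congruent. [folklore] -/
theorem exists_transpose_mul_mul_eq [IsAlgClosed K] (h2 : (2 : K) ≠ 0) {n : ℕ}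
    (M M' : Matrix (Fin n) (Fin n) K) (hM : M.IsSymm) (hdet : M.det ≠ 0) (hM' : M'.IsSymm)
    (hdet' : M'.det ≠ 0) :
    ∃ P : Matrix (Fin n) (Fin n) K, P.det ≠ 0 ∧ Pᵀ * M * P = M' := by
  obtain ⟨P, hP, hPM⟩ := exists_transpose_mul_mul_eq_one h2 M hM hdet
  obtain ⟨P', hP', hPM'⟩ := exists_transpose_mul_mul_eq_one h2 M' hM' hdet'
  have hu' : IsUnit P'.det := isUnit_iff_ne_zero.2 hP'
  have hu't : IsUnit P'ᵀ.det := by rwa [Matrix.det_transpose]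
  refine ⟨P * P'⁻¹, ?_, ?_⟩
  · rw [Matrix.det_mul, Matrix.det_nonsing_inv, Ring.inverse_eq_inv']
    exact mul_ne_zero hP (inv_ne_zero hP')
  · have e : M' = (P'⁻¹)ᵀ * P'⁻¹ := by
      have h1 : (P'⁻¹)ᵀ * (P'ᵀ * M' * P') * P'⁻¹ = (P'⁻¹)ᵀ * P'⁻¹ := by rw [hPM', Matrix.mul_one]
      rw [← h1, Matrix.transpose_nonsing_inv, ← Matrix.mul_assoc, ← Matrix.mul_assoc,
        Matrix.nonsing_inv_mul _ hu't, Matrix.one_mul, Matrix.mul_assoc,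
        Matrix.mul_nonsing_inv _ hu', Matrix.mul_one]
    rw [e, Matrix.transpose_mul, Matrix.mul_assoc, Matrix.mul_assoc]
    congr 1
    rw [← Matrix.mul_assoc, ← Matrix.mul_assoc, hPM, Matrix.one_mul]

/-- The Plücker form as a bilinear form. [folklore] -/
theorem toBilin'_Q0_apply (x y : Fin 6 → K) :
    Matrix.toBilin' Q0 x y = x ⬝ᵥ (Q0 *ᵥ y) := Matrix.toBilin'_apply' _ _ _

/-- The Plücker pairing is symmetric. [folklore] -/
theorem dotProduct_Q0_mulVec_comm (x y : Fin 6 → K) : x ⬝ᵥ (Q0 *ᵥ y) = y ⬝ᵥ (Q0 *ᵥ x) := by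
  rw [Matrix.dotProduct_mulVec, ← Matrix.mulVec_transpose, Q0_transpose, dotProduct_comm]

/-- The matrix of the reflection in `u` for the Plücker form is `(pf u)⁻¹ R_u`. [folklore] -/
theorem toMatrix'_refl_Q0 (h2 : (2 : K) ≠ 0) (u : Fin 6 → K) (hu : pf u ≠ 0) :
    LinearMap.toMatrix' (refl (Matrix.toBilin' Q0) u) = (pf u)⁻¹ • Rm u := by
  ext i j
  rw [LinearMap.toMatrix'_apply, refl_apply, toBilin'_Q0_apply, toBilin'_Q0_apply,
    dotProduct_Q0_mulVec_self, dotProduct_Q0_mulVec_comm u, single_dotProduct, one_mul,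
    Matrix.smul_apply, Rm_apply, Pi.sub_apply, Pi.smul_apply, smul_eq_mul, smul_eq_mul,
    Pi.single_apply, Matrix.one_apply, show (2 : K) / (2 * pf u) = (pf u)⁻¹ by field_simp,
    mul_sub, ← mul_assoc (pf u)⁻¹, inv_mul_cancel₀ hu, one_mul]
  ring

/-- A matrix preserving the Plücker form acts as an isometry. [folklore] -/
theorem toBilin'_Q0_toLin' (G : Matrix (Fin 6) (Fin 6) K) (hG : Gᵀ * Q0 * G = Q0)
    (x y : Fin 6 → K) :
    Matrix.toBilin' Q0 (Matrix.toLin' G x) (Matrix.toLin' G y) = Matrix.toBilin' Q0 x y := by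
  rw [toBilin'_Q0_apply, toBilin'_Q0_apply, Matrix.toLin'_apply, Matrix.toLin'_apply,
    Matrix.mulVec_mulVec, ← Matrix.vecMul_transpose, Matrix.dotProduct_mulVec,
    Matrix.vecMul_vecMul, ← Matrix.mul_assoc, hG, ← Matrix.dotProduct_mulVec]

/-- `LinearMap.toMatrix'` of a product of a list of endomorphisms. [folklore] -/
theorem toMatrix'_list_prod {n : ℕ} (l : List (Module.End K (Fin n → K))) :
    LinearMap.toMatrix' l.prod = (l.map fun f => LinearMap.toMatrix' f).prod :=
  map_list_prod (LinearMap.toMatrixAlgEquiv' : Module.End K (Fin n → K) ≃ₐ[K] _) l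

/-- `det Q₀ ≠ 0`. [folklore] -/
theorem det_Q0_ne_zero : (Q0 : Matrix (Fin 6) (Fin 6) K).det ≠ 0 := by
  intro h
  have hd := congrArg Matrix.det (Q0_mul_Q0 (R := K))
  rw [Matrix.det_mul, h, zero_mul, Matrix.det_one] at hd
  exact zero_ne_one hd

/-- Nonzero scalar multiples of an invertible matrix determine the scalar. [folklore] -/
theorem smul_left_injective_of_det_ne_zero {n : ℕ} {M : Matrix (Fin (n + 1)) (Fin (n + 1)) K}
    (hM : M.det ≠ 0) {a b : K} (h : a • M = b • M) : a = b := by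
  have hMu : IsUnit M.det := isUnit_iff_ne_zero.2 hM
  have h1 := congrArg (fun X => (X * M⁻¹) 0 0) h
  simpa [Matrix.smul_mul, Matrix.mul_nonsing_inv _ hMu] using h1

/-- **Weak Cartan–Dieudonné for the Plücker form, in matrices**: every `G` with `Gᵀ Q₀ G = Q₀`
is a product of reflection matrices `(pf u)⁻¹ R_u` with `pf u ≠ 0`. [folklore] -/
theorem exists_list_eq_prod_smul_Rm (h2 : (2 : K) ≠ 0) (G : Matrix (Fin 6) (Fin 6) K)
    (hG : Gᵀ * Q0 * G = Q0) :
    ∃ l : List (Fin 6 → K), (∀ u ∈ l, pf u ≠ 0) ∧ G = (l.map fun u => (pf u)⁻¹ • Rm u).prod := by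
  haveI : Invertible (2 : K) := invertibleOfNonzero h2
  have hQdet : (Q0 : Matrix (Fin 6) (Fin 6) K).det ≠ 0 := det_Q0_ne_zero
  have hQs : (Q0 : Matrix (Fin 6) (Fin 6) K).IsSymm := Q0_transpose
  obtain ⟨b, hbo, hba⟩ := exists_orthogonal_basis_toBilin' Q0 hQs hQdet
  obtain ⟨l, hl, hprod⟩ := exists_list_prod_refl_eq h2 (Matrix.isSymm_toBilin'_iff_isSymm.2 hQs)
    b hbo hba (Matrix.toLin' G) (toBilin'_Q0_toLin' G hG)
  have hl' : ∀ u ∈ l, pf u ≠ 0 := fun u hu h =>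
    hl u hu (by rw [toBilin'_Q0_apply, dotProduct_Q0_mulVec_self, h, mul_zero])
  refine ⟨l, hl', ?_⟩
  have hm := congrArg LinearMap.toMatrix' hprod
  rw [LinearMap.toMatrix'_toLin', toMatrix'_list_prod, List.map_map] at hm
  rw [hm]
  congr 1
  refine List.map_congr_left fun u hu => ?_
  exact toMatrix'_refl_Q0 h2 u (hl' u hu)

/-- A reflection matrix has determinant `-1`. [folklore] -/
theorem det_smul_Rm (u : Fin 6 → K) (hu : pf u ≠ 0) : ((pf u)⁻¹ • Rm u).det = -1 := by
  have e : (pf u)⁻¹ • Rm u = 1 + Matrix.vecMulVec (-((pf u)⁻¹ • u)) (Q0 *ᵥ u) := by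
    rw [Rm, smul_sub, smul_smul, inv_mul_cancel₀ hu, one_smul, ← Matrix.smul_vecMulVec,
      Matrix.neg_vecMulVec, sub_eq_add_neg]
  rw [e, Matrix.vecMulVec_eq (Fin 1), Matrix.det_one_add_replicateCol_mul_replicateRow,
    dotProduct_neg, dotProduct_smul, dotProduct_comm, dotProduct_Q0_mulVec_self, smul_eq_mul]
  field_simp
  ring

/-- A product of `m` reflection matrices has determinant `(-1)^m`. [folklore] -/
theorem det_list_prod_smul_Rm (l : List (Fin 6 → K)) (hl : ∀ u ∈ l, pf u ≠ 0) :
    ((l.map fun u => (pf u)⁻¹ • Rm u).prod).det = (-1) ^ l.length := by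
  induction l with
  | nil => simp
  | cons u l ih =>
    rw [List.map_cons, List.prod_cons, Matrix.det_mul, det_smul_Rm u (hl u (by simp)),
      ih fun w hw => hl w (by simp [hw]), List.length_cons, pow_succ]
    ring

/-- A `4 × 4` skew matrix with nonzero Pfaffian is invertible. [folklore] -/
theorem det_skew_ne_zero {u : Fin 6 → K} (hu : pf u ≠ 0) : (skew u).det ≠ 0 := by
  have hd := congrArg Matrix.det (skew_mul_skew_star u)
  rw [Matrix.det_mul, Matrix.det_smul, Matrix.det_one, mul_one, Fintype.card_fin] at hd
  exact left_ne_zero_of_mul (hd ▸ pow_ne_zero 4 hu)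

/-- Pairing up reflections: a product of an even number of reflection matrices is a nonzero
multiple of `C₂` of an invertible matrix. [folklore] -/
theorem exists_eq_smul_C2_of_even :
    ∀ l : List (Fin 6 → K), (∀ u ∈ l, pf u ≠ 0) → Even l.length →
      ∃ (h : Matrix (Fin 4) (Fin 4) K) (c : K), c ≠ 0 ∧ h.det ≠ 0 ∧
        (l.map fun u => (pf u)⁻¹ • Rm u).prod = c • C2 h
  | [], _, _ => ⟨1, 1, one_ne_zero, by simp, by simp⟩
  | [u], _, h => by simp at h
  | u :: w :: l, hl, he => by
    have hu : pf u ≠ 0 := hl u (by simp)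
    have hw : pf w ≠ 0 := hl w (by simp)
    have he' : Even l.length := by simpa [Nat.even_add_one, parity_simps] using he
    obtain ⟨h, c, hc, hh, hprod⟩ :=
      exists_eq_smul_C2_of_even l (fun x hx => hl x (by simp [hx])) he'
    refine ⟨skew u * skew (star w) * h, (pf u)⁻¹ * (pf w)⁻¹ * c, ?_, ?_, ?_⟩
    · exact mul_ne_zero (mul_ne_zero (inv_ne_zero hu) (inv_ne_zero hw)) hc
    · rw [Matrix.det_mul, Matrix.det_mul]
      refine mul_ne_zero (mul_ne_zero (det_skew_ne_zero hu) (det_skew_ne_zero ?_)) hh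
      rwa [pf_star]
    · rw [List.map_cons, List.map_cons, List.prod_cons, List.prod_cons, hprod, C2_mul,
        C2_skew_mul_skew_star]
      simp only [Matrix.smul_mul, Matrix.mul_smul, smul_smul, mul_assoc]
      congr 1
      ring

/-- **Surjectivity of `GSpin₆ → SO₆` on points** (`D₃ = A₃`): every matrix in `SO(Q₀)(K)`,
`K` a field of characteristic `≠ 2`, is a nonzero multiple of the second compound of an
invertible `4 × 4` matrix. [folklore] -/
theorem exists_eq_smul_C2 (h2 : (2 : K) ≠ 0) (G : Matrix (Fin 6) (Fin 6) K)
    (hG : Gᵀ * Q0 * G = Q0) (hdet : G.det = 1) :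
    ∃ (h : Matrix (Fin 4) (Fin 4) K) (c : K), c ≠ 0 ∧ h.det ≠ 0 ∧ G = c • C2 h := by
  obtain ⟨l, hl, rfl⟩ := exists_list_eq_prod_smul_Rm h2 G hG
  refine exists_eq_smul_C2_of_even l hl ?_
  rw [det_list_prod_smul_Rm l hl] at hdet
  refine (neg_one_pow_eq_one_iff_even fun h => h2 ?_).1 hdet
  linear_combination -h

end MatrixForm

section Lift

variable {K : Type*} [Field K]

/-- **Kernel of `C₂` modulo scalars**: if `C₂ x` is a nonzero multiple of `C₂ y` with `y`
invertible, then `x` is a nonzero multiple of `y` (from `N ∘ C₂ = 2 M₁₂₃ • id`). [folklore] -/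
theorem exists_eq_smul_of_C2_eq_smul (h2 : (2 : K) ≠ 0) {x y : Matrix (Fin 4) (Fin 4) K} {e : K}
    (hy : y.det ≠ 0) (he : e ≠ 0) (h : C2 x = e • C2 y) : ∃ d : K, d ≠ 0 ∧ x = d • y := by
  have hyu : IsUnit y.det := isUnit_iff_ne_zero.2 hy
  set z := y⁻¹ * x with hz
  have hC : C2 z = e • (1 : Matrix (Fin 6) (Fin 6) K) := by
    have h1 : C2 y⁻¹ * C2 y = 1 := by rw [← C2_mul, Matrix.nonsing_inv_mul _ hyu, C2_one]
    rw [hz, C2_mul, h, Matrix.mul_smul, h1]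
  have hN := N_C2 z
  rw [hC, N_smul, N_one, smul_smul] at hN
  have h00 := congrFun (congrFun hN 0) 0
  simp only [Matrix.smul_apply, Matrix.one_apply_eq, smul_eq_mul, mul_one] at h00
  have hM : 2 * M123 z ≠ 0 := by
    intro h0
    rw [h0, zero_mul] at h00
    exact mul_ne_zero (pow_ne_zero 2 he) h2 h00
  refine ⟨(2 * M123 z)⁻¹ * (e ^ 2 * 2), mul_ne_zero (inv_ne_zero hM)
    (mul_ne_zero (pow_ne_zero 2 he) h2), ?_⟩
  calc x = y * z := by rw [hz, Matrix.mul_nonsing_inv_cancel_left _ _ hyu]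
    _ = y * ((2 * M123 z)⁻¹ • ((e ^ 2 * 2) • (1 : Matrix (Fin 4) (Fin 4) K))) := by
      rw [hN, inv_smul_smul₀ hM]
    _ = ((2 * M123 z)⁻¹ * (e ^ 2 * 2)) • y := by
      rw [smul_smul, Matrix.mul_smul, Matrix.mul_one]

/-- The scalar element of `GL₄` with value `u` is the matrix `u • 1`. [folklore] -/
theorem coe_scalar_eq_smul_one (u : Kˣ) :
    ((Matrix.GeneralLinearGroup.scalar (Fin 4) u : GL (Fin 4) K) : Matrix (Fin 4) (Fin 4) K) =
      (u : K) • (1 : Matrix (Fin 4) (Fin 4) K) := by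
  rw [Matrix.GeneralLinearGroup.coe_scalar, Matrix.scalar_apply, Matrix.smul_one_eq_diagonal]

/-- Two invertible matrices differing by a nonzero scalar have the same image in `PGL₄`. [folklore]
-/
theorem mk_eq_mk_of_val_eq_smul {x y : GL (Fin 4) K} {d : K} (hd : d ≠ 0)
    (h : (x : Matrix (Fin 4) (Fin 4) K) = d • (y : Matrix (Fin 4) (Fin 4) K)) :
    (QuotientGroup.mk x : GL (Fin 4) K ⧸ Subgroup.center (GL (Fin 4) K)) = QuotientGroup.mk y := by
  have hxy : x = y * Matrix.GeneralLinearGroup.scalar (Fin 4) (Units.mk0 d hd) := by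
    refine Matrix.GeneralLinearGroup.ext fun i j => ?_
    rw [Matrix.GeneralLinearGroup.coe_mul, coe_scalar_eq_smul_one, Matrix.mul_smul,
      Matrix.mul_one, h]
    rfl
  have hs : (QuotientGroup.mk (Matrix.GeneralLinearGroup.scalar (Fin 4) (Units.mk0 d hd)) :
      GL (Fin 4) K ⧸ Subgroup.center (GL (Fin 4) K)) = 1 := by
    rw [QuotientGroup.eq_one_iff, Matrix.GeneralLinearGroup.center_eq_range_scalar]
    exact ⟨_, rfl⟩
  rw [hxy, QuotientGroup.mk_mul, hs, mul_one]

/-- If `C₂ x` is a nonzero multiple of `C₂ y`, then `x` and `y` agree in `PGL₄`. [folklore] -/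
theorem mk_eq_mk_of_C2_eq_smul (h2 : (2 : K) ≠ 0) {x y : GL (Fin 4) K} {e : K} (he : e ≠ 0)
    (h : C2 (x : Matrix (Fin 4) (Fin 4) K) = e • C2 (y : Matrix (Fin 4) (Fin 4) K)) :
    (QuotientGroup.mk x : GL (Fin 4) K ⧸ Subgroup.center (GL (Fin 4) K)) = QuotientGroup.mk y := by
  have hy : (y : Matrix (Fin 4) (Fin 4) K).det ≠ 0 := by
    rw [← Matrix.GeneralLinearGroup.val_det_apply]
    exact (Matrix.GeneralLinearGroup.det y).ne_zero
  obtain ⟨d, hd, hxy⟩ := exists_eq_smul_of_C2_eq_smul h2 hy he h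
  exact mk_eq_mk_of_val_eq_smul hd hxy

open Classical in
/-- A chosen `C₂`-preimage up to scalars of a `6 × 6` matrix (junk value `1` if none exists).
[folklore] -/
noncomputable def liftMat (G : Matrix (Fin 6) (Fin 6) K) : Matrix (Fin 4) (Fin 4) K :=
  if h : ∃ (x : Matrix (Fin 4) (Fin 4) K) (c : K), c ≠ 0 ∧ x.det ≠ 0 ∧ G = c • C2 x then
    h.choose else 1

/-- The defining property of `liftMat` when a preimage exists. [folklore] -/
theorem liftMat_spec {G : Matrix (Fin 6) (Fin 6) K}
    (h : ∃ (x : Matrix (Fin 4) (Fin 4) K) (c : K), c ≠ 0 ∧ x.det ≠ 0 ∧ G = c • C2 x) :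
    ∃ c : K, c ≠ 0 ∧ (liftMat G).det ≠ 0 ∧ G = c • C2 (liftMat G) := by
  rw [liftMat, dif_pos h]
  exact h.choose_spec

/-- `liftMat G` is always invertible (by the junk value `1` otherwise). [folklore] -/
theorem det_liftMat_ne_zero (G : Matrix (Fin 6) (Fin 6) K) : (liftMat G).det ≠ 0 := by
  classical
  by_cases h : ∃ (x : Matrix (Fin 4) (Fin 4) K) (c : K), c ≠ 0 ∧ x.det ≠ 0 ∧ G = c • C2 x
  · obtain ⟨c, -, hd, -⟩ := liftMat_spec h
    exact hd
  · rw [liftMat, dif_neg h, Matrix.det_one]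
    exact one_ne_zero

/-- The chosen preimage as an element of `GL₄`. [folklore] -/
noncomputable def liftGL (G : Matrix (Fin 6) (Fin 6) K) : GL (Fin 4) K :=
  Matrix.GeneralLinearGroup.mkOfDetNeZero (liftMat G) (det_liftMat_ne_zero G)

/-- Unfolding lemma for `liftGL`. [folklore] -/
@[simp] theorem coe_liftGL (G : Matrix (Fin 6) (Fin 6) K) :
    (liftGL G : Matrix (Fin 4) (Fin 4) K) = liftMat G := rfl

/-- The defining property of `liftGL` on `SO(Q₀)(K)`. [folklore] -/
theorem liftGL_spec (h2 : (2 : K) ≠ 0) {G : Matrix (Fin 6) (Fin 6) K} (hG : Gᵀ * Q0 * G = Q0)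
    (hdet : G.det = 1) :
    ∃ c : K, c ≠ 0 ∧ G = c • C2 (liftGL G : Matrix (Fin 4) (Fin 4) K) := by
  obtain ⟨c, hc, -, h⟩ := liftMat_spec (exists_eq_smul_C2 h2 G hG hdet)
  exact ⟨c, hc, h⟩

variable {Γ : Type*} [Group Γ]

/-- **The lift `Γ → PGL₄(K)` of an `SO(Q₀)`-valued homomorphism** through `D₃ = A₃`. [folklore] -/
noncomputable def liftHom (h2 : (2 : K) ≠ 0) (g : Γ →* GL (Fin 6) K)
    (hg : ∀ σ, ((g σ).val)ᵀ * Q0 * (g σ).val = Q0) (hg' : ∀ σ, ((g σ).val).det = 1) :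
    Γ →* GL (Fin 4) K ⧸ Subgroup.center (GL (Fin 4) K) where
  toFun σ := QuotientGroup.mk (liftGL (g σ).val)
  map_one' := by
    obtain ⟨c, hc, h⟩ := liftGL_spec h2 (hg 1) (hg' 1)
    rw [← QuotientGroup.mk_one]
    refine (mk_eq_mk_of_C2_eq_smul h2 hc ?_).symm
    rw [← h]
    simp only [map_one, Matrix.GeneralLinearGroup.coe_one, C2_one]
  map_mul' σ τ := by
    obtain ⟨c, hc, h⟩ := liftGL_spec h2 (hg (σ * τ)) (hg' (σ * τ))
    obtain ⟨cσ, hcσ, hσ⟩ := liftGL_spec h2 (hg σ) (hg' σ)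
    obtain ⟨cτ, hcτ, hτ⟩ := liftGL_spec h2 (hg τ) (hg' τ)
    have e1 : C2 (liftGL (g (σ * τ)).val).val = c⁻¹ • (g (σ * τ)).val := by
      conv_rhs => rw [h, inv_smul_smul₀ hc]
    have e2 : C2 (liftGL (g σ).val).val = cσ⁻¹ • (g σ).val := by
      conv_rhs => rw [hσ, inv_smul_smul₀ hcσ]
    have e3 : C2 (liftGL (g τ).val).val = cτ⁻¹ • (g τ).val := by
      conv_rhs => rw [hτ, inv_smul_smul₀ hcτ]
    rw [← QuotientGroup.mk_mul]
    refine (mk_eq_mk_of_C2_eq_smul h2 (e := cσ⁻¹ * cτ⁻¹ * c)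
      (mul_ne_zero (mul_ne_zero (inv_ne_zero hcσ) (inv_ne_zero hcτ)) hc) ?_).symm
    rw [Matrix.GeneralLinearGroup.coe_mul, C2_mul, e1, e2, e3, map_mul,
      Matrix.GeneralLinearGroup.coe_mul]
    simp only [Matrix.smul_mul, Matrix.mul_smul, smul_smul]
    congr 1
    field_simp

/-- Unfolding lemma for `liftHom`. [folklore] -/
theorem liftHom_apply (h2 : (2 : K) ≠ 0) (g : Γ →* GL (Fin 6) K)
    (hg : ∀ σ, ((g σ).val)ᵀ * Q0 * (g σ).val = Q0) (hg' : ∀ σ, ((g σ).val).det = 1) (σ : Γ) :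
    liftHom h2 g hg hg' σ = QuotientGroup.mk (liftGL (g σ).val) := rfl

/-- `liftHom g` is trivial wherever `g` is (it factors through the values of `g`). [folklore] -/
theorem liftHom_eq_one_of (h2 : (2 : K) ≠ 0) (g : Γ →* GL (Fin 6) K)
    (hg : ∀ σ, ((g σ).val)ᵀ * Q0 * (g σ).val = Q0) (hg' : ∀ σ, ((g σ).val).det = 1) {σ : Γ}
    (h : g σ = 1) : liftHom h2 g hg hg' σ = 1 := by
  rw [← map_one (liftHom h2 g hg hg'), liftHom_apply, liftHom_apply, h, map_one]

/-- Any representative of `liftHom g σ` has `C₂` a nonzero multiple of `g σ`. [folklore] -/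
theorem exists_C2_eq_smul_of_mk_eq_liftHom (h2 : (2 : K) ≠ 0) (g : Γ →* GL (Fin 6) K)
    (hg : ∀ σ, ((g σ).val)ᵀ * Q0 * (g σ).val = Q0) (hg' : ∀ σ, ((g σ).val).det = 1)
    (σ : Γ) (w : GL (Fin 4) K)
    (hw : (QuotientGroup.mk w : GL (Fin 4) K ⧸ Subgroup.center (GL (Fin 4) K)) =
      liftHom h2 g hg hg' σ) :
    ∃ ν : K, ν ≠ 0 ∧ C2 w.val = ν • (g σ).val := by
  obtain ⟨c, hc, h⟩ := liftGL_spec h2 (hg σ) (hg' σ)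
  rw [liftHom_apply, QuotientGroup.eq, Matrix.GeneralLinearGroup.center_eq_range_scalar] at hw
  obtain ⟨u, hu⟩ := hw
  set L := liftGL (g σ).val with hL
  have hwL : w = L * Matrix.GeneralLinearGroup.scalar (Fin 4) u⁻¹ := by
    rw [map_inv, hu, _root_.mul_inv_rev, inv_inv, mul_inv_cancel_left]
  have hwL' : w.val = ((u⁻¹ : Kˣ) : K) • L.val := by
    rw [hwL, Matrix.GeneralLinearGroup.coe_mul, coe_scalar_eq_smul_one, Matrix.mul_smul,
      Matrix.mul_one]
  refine ⟨((u⁻¹ : Kˣ) : K) ^ 2 * c⁻¹,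
    mul_ne_zero (pow_ne_zero 2 (Units.ne_zero _)) (inv_ne_zero hc), ?_⟩
  rw [hwL', C2_smul, mul_smul, h, smul_smul (c⁻¹), inv_mul_cancel₀ hc, one_smul]

end Lift

section Topology

open Filter Topology

variable {K : Type*} [Field K] [TopologicalSpace K] [IsTopologicalRing K]

/-- `C₂` is continuous (polynomial entries). [folklore] -/
theorem continuous_C2 : Continuous (C2 : Matrix (Fin 4) (Fin 4) K → Matrix (Fin 6) (Fin 6) K) := by
  have hc : ∀ i j, Continuous fun m : Matrix (Fin 4) (Fin 4) K => m i j :=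
    fun i j => (continuous_apply j).comp (continuous_apply i)
  refine continuous_matrix fun a b => ?_
  simp only [C2_apply]
  fun_prop

/-- `N` is continuous (polynomial entries). [folklore] -/
theorem continuous_N : Continuous (N : Matrix (Fin 6) (Fin 6) K → Matrix (Fin 4) (Fin 4) K) := by
  have hc : ∀ i j, Continuous fun m : Matrix (Fin 6) (Fin 6) K => m i j :=
    fun i j => (continuous_apply j).comp (continuous_apply i)
  refine continuous_matrix fun i j => ?_
  fin_cases i <;> fin_cases j <;> simp [N] <;> fun_prop

variable [ContinuousInv₀ K] [T1Space K] {Γ : Type*} [Group Γ] [TopologicalSpace Γ]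
  [IsTopologicalGroup Γ]

/-- **Continuity of the lift** `Γ → PGL₄(K)` (quotient topology) of a continuous `SO(Q₀)`-valued
homomorphism: near `1` it is `σ ↦ [N(g σ)]`, and `N` is polynomial. [folklore] -/
theorem continuous_liftHom (h2 : (2 : K) ≠ 0) (g : Γ →* GL (Fin 6) K) (hgc : Continuous g)
    (hg : ∀ σ, ((g σ).val)ᵀ * Q0 * (g σ).val = Q0) (hg' : ∀ σ, ((g σ).val).det = 1) :
    Continuous (liftHom h2 g hg hg') := by
  classical
  apply continuous_of_continuousAt_one
  set A : Γ → Matrix (Fin 4) (Fin 4) K := fun σ => N (g σ).val with hA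
  have hAc : Continuous A := continuous_N.comp (Units.continuous_val.comp hgc)
  have hA1 : A 1 = (2 : K) • (1 : Matrix (Fin 4) (Fin 4) K) := by
    simp only [hA, map_one, Units.val_one]
    exact N_one
  have hdet1 : (A 1).det ≠ 0 := by
    rw [hA1, Matrix.det_smul, Matrix.det_one, mul_one, Fintype.card_fin]
    exact pow_ne_zero _ h2
  have hU : ∀ᶠ σ in 𝓝 (1 : Γ), (A σ).det ≠ 0 :=
    (hAc.matrix_det.continuousAt (x := 1)).eventually_ne hdet1
  let B : Γ → GL (Fin 4) K := fun σ =>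
    if h : (A σ).det ≠ 0 then Matrix.GeneralLinearGroup.mkOfDetNeZero (A σ) h else 1
  have hB : ∀ σ, (A σ).det ≠ 0 → (B σ).val = A σ := fun σ h => by
    simp only [B, dif_pos h]
    rfl
  have hEq : ∀ σ, (A σ).det ≠ 0 → liftHom h2 g hg hg' σ = QuotientGroup.mk (B σ) := by
    intro σ hσ
    obtain ⟨c, hc, h⟩ := liftGL_spec h2 (hg σ) (hg' σ)
    have hAσ : A σ = (c ^ 2 * (2 * M123 (liftGL (g σ).val).val)) • (liftGL (g σ).val).val := by
      simp only [hA]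
      conv_lhs => rw [h]
      rw [N_smul, N_C2, smul_smul]
    have hd : c ^ 2 * (2 * M123 (liftGL (g σ).val).val) ≠ 0 := by
      intro h0
      apply hσ
      rw [hAσ, h0, zero_smul, Matrix.det_zero]
    rw [liftHom_apply]
    exact (mk_eq_mk_of_val_eq_smul hd (by rw [hB σ hσ, hAσ, coe_liftGL])).symm
  have hBc : ContinuousAt B 1 := by
    rw [Units.isInducing_embedProduct.continuousAt_iff]
    have h1 : ContinuousAt (fun σ => (B σ).val) 1 :=
      hAc.continuousAt.congr (hU.mono fun σ hσ => (hB σ hσ).symm)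
    have h3 : ContinuousAt (fun σ => ((B σ)⁻¹).val) 1 := by
      have : ContinuousAt (fun σ => (A σ)⁻¹) 1 := by
        refine ContinuousAt.comp (continuousAt_matrix_inv (A 1) ?_) hAc.continuousAt
        rw [Ring.inverse_eq_inv']
        exact continuousAt_inv₀ hdet1
      refine this.congr (hU.mono fun σ hσ => ?_)
      dsimp only
      rw [Matrix.coe_units_inv, hB σ hσ]
    exact h1.prodMk (MulOpposite.continuous_op.continuousAt.comp h3)
  have hmk : ContinuousAt
      (fun σ => (QuotientGroup.mk (B σ) : GL (Fin 4) K ⧸ Subgroup.center (GL (Fin 4) K))) 1 :=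
    QuotientGroup.continuous_mk.continuousAt.comp hBc
  exact hmk.congr (hU.mono fun σ hσ => (hEq σ hσ).symm)

end Topology

end SpinLift

/-! ### Assembly over `ℚ̄_ℓ` -/

section Assembly

open Field IsDedekindDomain SpinLift
open scoped NumberField Matrix

variable {F : Type} [Field F] [NumberField F] {ℓ : ℕ} [Fact ℓ.Prime]

omit [NumberField F] in
/-- **The `D₃ = A₃` transfer for a six-dimensional special orthogonal `ℓ`-adic representation.**
For a continuous `r : Γ_F → GL₆(ℚ̄_ℓ)` preserving a non-degenerate symmetric `J` with `det r = 1`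
there is a continuous projective representation `φ : Γ_F → PGL₄(ℚ̄_ℓ)` (namely
`σ ↦ [h_σ]`, `∧²h_σ ∝ P⁻¹ r(σ) P` for a fixed `P` with `Pᵀ J P = Q₀`), trivial wherever `r` is,
such that EVERY continuous lift `W : Γ_F → GL₄(ℚ̄_ℓ)` of `φ` comes with a continuous character
`ν` satisfying the trace identity `ν(σ) tr r(σ) = ((tr W(σ))² − tr W(σ²)) / 2`. [folklore] -/
theorem exists_projective_spinDatum (r : FramedGaloisRep F (PadicAlgCl ℓ) 6)
    (hJ : ∃ J : Matrix (Fin 6) (Fin 6) (PadicAlgCl ℓ), J.IsSymm ∧ IsUnit J ∧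
      ∀ σ, ((r σ : GL (Fin 6) (PadicAlgCl ℓ)) : Matrix (Fin 6) (Fin 6) (PadicAlgCl ℓ))ᵀ * J *
        ((r σ : GL (Fin 6) (PadicAlgCl ℓ)) : Matrix (Fin 6) (Fin 6) (PadicAlgCl ℓ)) = J)
    (hdet : ∀ σ, FramedRep.det r σ = 1) :
    ∃ φ : absoluteGaloisGroup F →ₜ*
        (GL (Fin 4) (PadicAlgCl ℓ) ⧸ Subgroup.center (GL (Fin 4) (PadicAlgCl ℓ))),
      (∀ σ, r σ = 1 → φ σ = 1) ∧
      ∀ W : FramedGaloisRep F (PadicAlgCl ℓ) 4,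
        (∀ σ, (QuotientGroup.mk (W σ) :
            GL (Fin 4) (PadicAlgCl ℓ) ⧸ Subgroup.center (GL (Fin 4) (PadicAlgCl ℓ))) = φ σ) →
        ∃ ν : absoluteGaloisGroup F →ₜ* (PadicAlgCl ℓ)ˣ,
          ∀ σ, (ν σ : PadicAlgCl ℓ) * FramedRep.trace r σ =
            (FramedRep.trace W σ ^ 2 - FramedRep.trace W (σ * σ)) / 2 := by
  have h2 : (2 : PadicAlgCl ℓ) ≠ 0 := two_ne_zero
  obtain ⟨J, hJs, hJu, hrJ⟩ := hJ
  have hJdet : J.det ≠ 0 := ((Matrix.isUnit_iff_isUnit_det J).1 hJu).ne_zero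
  obtain ⟨P, hP, hPJ⟩ :=
    exists_transpose_mul_mul_eq h2 J Q0 hJs hJdet Q0_transpose det_Q0_ne_zero
  have hPu : IsUnit P.det := isUnit_iff_ne_zero.2 hP
  set Pu : GL (Fin 6) (PadicAlgCl ℓ) := Matrix.GeneralLinearGroup.mkOfDetNeZero P hP with hPu_def
  have hPuval : Pu.val = P := rfl
  set g : FramedGaloisRep F (PadicAlgCl ℓ) 6 := FramedRep.conj Pu⁻¹ r with hg_def
  have hgapply : ∀ σ, g σ = Pu⁻¹ * r σ * Pu := fun σ => by
    rw [hg_def, FramedRep.conj_apply, inv_inv]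
  have hgval : ∀ σ, (g σ).val = P⁻¹ * (r σ).val * P := fun σ => by
    rw [hgapply, Units.val_mul, Units.val_mul, Matrix.coe_units_inv, hPuval]
  -- `g` is `SO(Q₀)`-valued
  have hg : ∀ σ, ((g σ).val)ᵀ * Q0 * (g σ).val = Q0 := fun σ => by
    have hPS : P * (g σ).val = (r σ).val * P := by
      rw [hgval, ← Matrix.mul_assoc, ← Matrix.mul_assoc, Matrix.mul_nonsing_inv _ hPu,
        Matrix.one_mul]
    calc ((g σ).val)ᵀ * Q0 * (g σ).val = ((g σ).val)ᵀ * (Pᵀ * J * P) * (g σ).val := by rw [hPJ]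
      _ = (P * (g σ).val)ᵀ * J * (P * (g σ).val) := by
        rw [Matrix.transpose_mul]; simp only [Matrix.mul_assoc]
      _ = ((r σ).val * P)ᵀ * J * ((r σ).val * P) := by rw [hPS]
      _ = Pᵀ * (((r σ).val)ᵀ * J * (r σ).val) * P := by
        rw [Matrix.transpose_mul]; simp only [Matrix.mul_assoc]
      _ = Q0 := by rw [hrJ σ, hPJ]
  have hg' : ∀ σ, ((g σ).val).det = 1 := fun σ => by
    have h1 : Matrix.GeneralLinearGroup.det (r σ) = 1 := by
      rw [← FramedRep.det_apply]; exact hdet σ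
    have h3 : Matrix.GeneralLinearGroup.det (g σ) = 1 := by
      rw [hgapply, map_mul, map_mul, h1, mul_one, ← map_mul, inv_mul_cancel, map_one]
    rw [← Matrix.GeneralLinearGroup.val_det_apply, h3, Units.val_one]
  -- the projective representation
  let φ : absoluteGaloisGroup F →ₜ*
      (GL (Fin 4) (PadicAlgCl ℓ) ⧸ Subgroup.center (GL (Fin 4) (PadicAlgCl ℓ))) :=
    { toMonoidHom := liftHom h2 (g : absoluteGaloisGroup F →* GL (Fin 6) (PadicAlgCl ℓ)) hg hg'
      continuous_toFun := continuous_liftHom h2 _ (map_continuous g) hg hg' }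
  have hφ : ∀ σ, φ σ = liftHom h2 (g : absoluteGaloisGroup F →* GL (Fin 6) (PadicAlgCl ℓ))
    hg hg' σ := fun σ => rfl
  refine ⟨φ, fun σ hσ => ?_, fun W hW => ?_⟩
  · rw [hφ]
    refine liftHom_eq_one_of h2 _ hg hg' ?_
    change g σ = 1
    rw [hgapply, hσ, mul_one, inv_mul_cancel]
  -- the multiplier character of a lift `W`
  have hex : ∀ σ, ∃ ν : PadicAlgCl ℓ, ν ≠ 0 ∧ C2 (W σ).val = ν • (g σ).val := fun σ =>
    exists_C2_eq_smul_of_mk_eq_liftHom h2 _ hg hg' σ (W σ) (hW σ)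
  choose ν hν0 hν using hex
  have hνmul : ∀ σ τ, ν (σ * τ) = ν σ * ν τ := fun σ τ => by
    have e1 : C2 (W (σ * τ)).val = (ν σ * ν τ) • (g (σ * τ)).val := by
      rw [map_mul, map_mul, Units.val_mul, Units.val_mul, C2_mul, hν σ, hν τ, Matrix.smul_mul,
        Matrix.mul_smul, smul_smul]
    rw [hν (σ * τ)] at e1
    exact smul_left_injective_of_det_ne_zero (by rw [hg']; exact one_ne_zero) e1
  have hν1 : ν 1 = 1 := by
    have e := hνmul 1 1
    rw [mul_one] at e
    exact (mul_eq_left₀ (hν0 1)).1 e.symm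
  let ν₀ : absoluteGaloisGroup F →* (PadicAlgCl ℓ)ˣ :=
    { toFun := fun σ => Units.mk0 (ν σ) (hν0 σ)
      map_one' := Units.ext hν1
      map_mul' := fun σ τ => Units.ext (by simp [hνmul]) }
  have hν₀ : ∀ σ, (ν₀ σ : PadicAlgCl ℓ) = ν σ := fun σ => rfl
  -- continuity of `ν` from `ν σ = tr (∧²W(σ) g(σ)⁻¹) / 6`
  have h6 : (6 : PadicAlgCl ℓ) ≠ 0 := by norm_num
  have hform : ∀ σ, ν σ = (6 : PadicAlgCl ℓ)⁻¹ * Matrix.trace (C2 (W σ).val * ((g σ)⁻¹).val) :=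
    fun σ => by
    rw [hν σ, Matrix.smul_mul, Units.mul_inv, Matrix.trace_smul, Matrix.trace_one,
      Fintype.card_fin, smul_eq_mul]
    field_simp
    norm_num
  have hνc : Continuous ν := by
    rw [show ν = fun σ => (6 : PadicAlgCl ℓ)⁻¹ * Matrix.trace (C2 (W σ).val * ((g σ)⁻¹).val) from
      funext hform]
    exact continuous_const.mul
      ((continuous_C2.comp (Units.continuous_val.comp (map_continuous W))).mul
        (Units.continuous_coe_inv.comp (map_continuous g))).matrix_trace
  have hν₀c : Continuous ν₀ := by
    refine Units.continuous_iff.2 ⟨hνc, ?_⟩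
    have : (fun σ => (((ν₀ σ)⁻¹ : (PadicAlgCl ℓ)ˣ) : PadicAlgCl ℓ)) = fun σ => ν σ⁻¹ :=
      funext fun σ => by rw [← map_inv ν₀ σ]; rfl
    rw [this]
    exact hνc.comp continuous_inv
  refine ⟨{ toMonoidHom := ν₀, continuous_toFun := hν₀c }, fun σ => ?_⟩
  change ν σ * Matrix.trace (r σ).val =
    (Matrix.trace (W σ).val ^ 2 - Matrix.trace (W (σ * σ)).val) / 2
  have htr : Matrix.trace (r σ).val = Matrix.trace (g σ).val := by
    rw [hgval σ, Matrix.trace_mul_cycle, Matrix.mul_nonsing_inv _ hPu, Matrix.one_mul]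
  rw [eq_div_iff h2, htr, ← smul_eq_mul (ν σ), ← Matrix.trace_smul, ← hν σ, mul_comm,
    two_mul_trace_C2, map_mul, Units.val_mul]

/-- **`Patrikis2019_exists_lift_projective` ⇒ spin lifts of six-dimensional special orthogonal
`ℓ`-adic Galois representations, for every continuous `r`** (Patrikis 2019, Ch. 2 §2.1, the
Proposition "lifting through central torus quotients" = Conrad, Prop. 5.3: "any continuous
representation `ρ : Γ_F → H(ℚ̄_ℓ)` lifts to `H'(ℚ̄_ℓ)`" for `H' ↠ H` with central torus kernel,
applied to `GSpin₆ ↠ SO₆` and read through `D₃ = A₃`).  For a number field `F`, a prime `ℓ` and a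
continuous `r : Γ_F → GL₆(ℚ̄_ℓ)` which preserves a non-degenerate symmetric bilinear form `J`
(`r(σ)ᵀ J r(σ) = J`) and has `det r = 1`, there are a continuous `W : Γ_F → GL₄(ℚ̄_ℓ)` and a
continuous character `ν : Γ_F → ℚ̄_ℓ^×` with `∧²W ≅ ν ⊗ r` in the form of the trace identity
`ν(σ) · tr r(σ) = ((tr W(σ))² − tr W(σ²)) / 2` for all `σ ∈ Γ_F` — no ramification hypothesis
and no ramification conclusion (for those see `Patrikis2019_exists_spinLift_of_lift_projective`).
Reduced to the same Proposition for `GL₄ ↠ PGL₄` (the tree's named fact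
`Patrikis2019_exists_lift_projective`, part (i)) by the explicit `D₃ = A₃` transfer of this file
(`exists_projective_spinDatum`).  This theorem carries the statement of the former named fact
`Patrikis2019_exists_spinLift_of_continuous` verbatim (merged into the projective fact,
D-0026/D-0027 review 2026-08-15); it is not a discharge: the projective fact is Tate's
`H²(Γ_F, ℚ/ℤ) = 0` for all number fields, which is not proved in the tree.
[cite: Patrikis2019, Ch. 2 §2.1, Proposition (lifting through central torus quotients) = arXiv:1207.6724 Prop. 1.0.18 = Conrad Prop. 5.3] -/
theorem Patrikis2019_exists_spinLift_of_continuous_of_lift_projective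
    (hX : Patrikis2019_exists_lift_projective) :
    ∀ (F : Type) [Field F] [NumberField F] (ℓ : ℕ) [Fact ℓ.Prime]
      (r : FramedGaloisRep F (PadicAlgCl ℓ) 6),
      (∃ J : Matrix (Fin 6) (Fin 6) (PadicAlgCl ℓ), J.IsSymm ∧ IsUnit J ∧
        ∀ σ, ((r σ : GL (Fin 6) (PadicAlgCl ℓ)) : Matrix (Fin 6) (Fin 6) (PadicAlgCl ℓ))ᵀ * J *
          ((r σ : GL (Fin 6) (PadicAlgCl ℓ)) : Matrix (Fin 6) (Fin 6) (PadicAlgCl ℓ)) = J) →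
      (∀ σ, FramedRep.det r σ = 1) →
        ∃ (W : FramedGaloisRep F (PadicAlgCl ℓ) 4) (ν : absoluteGaloisGroup F →ₜ* (PadicAlgCl ℓ)ˣ),
          ∀ σ, (ν σ : PadicAlgCl ℓ) * FramedRep.trace r σ =
              (FramedRep.trace W σ ^ 2 - FramedRep.trace W (σ * σ)) / 2 := by
  intro F _ _ ℓ _ r hJ hdet
  obtain ⟨φ, -, hφ⟩ := exists_projective_spinDatum r hJ hdet
  obtain ⟨W, hW⟩ := (hX F ℓ 4 φ).1
  obtain ⟨ν, hν⟩ := hφ W hW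
  exact ⟨W, ν, hν⟩

/-- **`Patrikis2019_exists_lift_projective` ⇒ `Patrikis2019_exists_spinLift`.**  The bundled
version with the Remark (Conrad Lemma 5.2): inertia groups killed by `r` are killed by the
projective representation `φ`, so part (ii) of the projective fact yields an almost everywhere
unramified `W`.
[cite: Patrikis2019, Ch. 2 §2.1, Proposition and the Remark after it (= arXiv:1207.6724 Prop. 1.0.18, Rem. 1.0.19)] -/
theorem Patrikis2019_exists_spinLift_of_lift_projective
    (hX : Patrikis2019_exists_lift_projective) : Patrikis2019_exists_spinLift := by
  intro F _ _ ℓ _ r hJ hdet hur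
  obtain ⟨φ, hφ1, hφ⟩ := exists_projective_spinDatum r hJ hdet
  obtain ⟨W, hW, hWur⟩ := (hX F ℓ 4 φ).2
    (hur.mono fun v hv 𝔓 h𝔓 σ hσ => hφ1 σ (hv 𝔓 h𝔓 σ hσ))
  obtain ⟨ν, hν⟩ := hφ W hW
  exact ⟨W, ν, hν, hWur⟩

end Assembly

end Literature.NumberTheory.GaloisRepresentations
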